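import Mathlib.NumberTheory.Zsqrtd.Basic
import Mathlib.NumberTheory.LegendreSymbol.Basic
import Mathlib.Data.Rat.Lemmas
import Mathlib.Tactic
import HarnessLib

/-!
# Weil-type family coverage — relative-norm congruences at a SPLIT prime of `ℤ[√d]`: the descent
# `A² − pγC² = Y·D² ⇒ Y ≡ □ (mod π)`, clearing denominators, and the two Pell-type sign lemmas
# (`d = 13, p = 3` for the census level `39`; `d = 2, p = 7` for the level `56`)

research route conditional on HC_CM; not a corollary; Q11.4-sentence-2 already refuted in dim ≥ 3.

Ring 2, WEIL-TYPE FAMILY-COVERAGE CENSUS (`HOME/WEIL-FAMILY-COVERAGE.md` `## b01`, blocks b01.25 (A) «at `M = 39`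
and `M = 56` the second `𝔽₂`-condition on unit signatures is the character `χ₁₃` resp. `χ₈`: every unit of
`ℚ(ζ₃₉)⁺ / ℚ(ζ₅₆)⁺` has totally positive relative norm to `ℚ(√13) / ℚ(√2)` (PARI-certified)» and b01.38 (E)
ROUTE NOTE «that positivity is ELEMENTARY by part 30's device read at a SPLIT prime»; owner ring2-b01), part 32
of the `Ring2WeilCoverage*` series — the ARITHMETIC CORE of the twisted obstruction at the index-2 levels.  Part
30 (`…QuarticNormObstruction`) descended in `ℤ[√5]` at an INERT prime; here the prime `p` SPLITS in `ℤ[√d]`,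
`p = π·π̄` with `π = −r₀ + √d`, `r₀² − d = p`, and the reduction `ρ : ℤ[√d] → ℤ/p`, `√d ↦ r₀` (Mathlib
`Zsqrtd.lift`) has kernel `(π)`:

* §1 `dvd_of_lift_eq_zero` / `lift_eq_zero_of_dvd` (`π ∣ x ↔ ρ(x) = 0`), `dvd_or_dvd_of_dvd_mul` (`π` is a prime
  element), and **THE DESCENT `isSquare_lift_of_eq`**: if `ρ(γ) ≠ 0`, `ρ(π̄) = −2r₀ ≠ 0`, then
  `A² − pγC² = Y·D²` with `N(D) ≠ 0` and `ρ(Y) ≠ 0` forces **`ρ(Y)` to be a (non-zero) SQUARE in `ℤ/p`**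
  (strong induction on `|N(D)|`: `π ∤ A` ⇒ `ρ(Y)ρ(D)² = ρ(A)² ≠ 0`; `π ∣ A` ⇒ `π ∣ D`, then `π ∣ C`, divide by
  `π²`).  This is the elementary shadow of local class field theory at `p`: a unit which is a norm from the
  quadratic extension `k(√(pγ))/k`, RAMIFIED at `π`, is a square modulo `π`.
* §2 `isSquare_lift_of_coords` — clearing denominators: for RATIONAL coordinates `a = a₁ + a₂√d`,
  `c = c₁ + c₂√d` and `β = p(g₁ + g₂√d)`, if `2(a² − βc²) = U + V√d` with `U, V ∈ ℤ` and `p ∤ U² − dV²`, then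
  `ρ(2U + 2V√d) = 2(U + Vr₀)` is a non-zero square mod `p`.
* (§3 = the companion file `…SplitPrimePellSigns`: the two Pell-type SIGN LEMMAS turning these congruences —
  at both primes `π, π̄`, i.e. `√d ↦ r₀` and `√d ↦ −r₀` — into TOTAL POSITIVITY of the unit `(U + V√d)/2`:
  `d = 13, p = 3` for the census level `39`, `d = 2, p = 7` for the level `56`.)

Consumer: part 33 (`…RelativeNormPositivity`: number fields `L ⊇ ℚ(√13, √(78 − 18√13))` resp. `ℚ(√2, √7)` —
every unit has totally positive relative norm to `ℚ(√13)` resp. `ℚ(√2)`), part 34/35 (the twisted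
unit-signature obstruction and the six census rows at `M = 39, 56`).  HONEST FRAMING: elementary arithmetic of
`ℤ[√d]`; nothing here mentions Hodge classes, polarisations, `W_K` or HC; `HC_CM` is used nowhere.  No `def`, no
named fact, no `sorry`.  Seat-derived [folklore] (the local class-field-theoretic statement behind it — norms of
units from a tamely ramified quadratic extension are the squares — is textbook and NOT used).
-/

namespace Summit.HodgeConjecture.Ring2WeilCoverage.SplitPrimeDescent

/-! ### §1 A split prime `p = π π̄` of `ℤ[√d]`, `π = −r₀ + √d`; the reduction `ρ : √d ↦ r₀` and the descent -/

section Split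

variable {d : ℤ} {p : ℕ} [Fact p.Prime] (r : { r : ZMod p // r * r = (d : ZMod p) }) {r₀ : ℤ}

/-- `ρ(a + b√d) = a + b·r₀` (Mathlib `Zsqrtd.lift`).
research route conditional on HC_CM; not a corollary; Q11.4-sentence-2 already refuted in dim ≥ 3. [folklore] -/
theorem lift_mk (a b : ℤ) : Zsqrtd.lift r (⟨a, b⟩ : ℤ√d) = (a : ZMod p) + (b : ZMod p) * (r : ZMod p) := by
  simp [Zsqrtd.lift]

/-- `ρ(π) = 0` for `π = −r₀ + √d` when `ρ(√d) = r₀`.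
research route conditional on HC_CM; not a corollary; Q11.4-sentence-2 already refuted in dim ≥ 3. [folklore] -/
theorem lift_pi (hr₀ : ((r₀ : ℤ) : ZMod p) = (r : ZMod p)) : Zsqrtd.lift r (⟨-r₀, 1⟩ : ℤ√d) = 0 := by
  rw [lift_mk]; push_cast; rw [hr₀]; ring

/-- **`ρ(x) = 0 ⇒ π ∣ x`** (`r₀² − d = p`): if `p ∣ a + b r₀`, `a + b r₀ = p k`, then
`a + b√d = (−r₀ + √d)·((b − r₀k) − k√d)`.
research route conditional on HC_CM; not a corollary; Q11.4-sentence-2 already refuted in dim ≥ 3. [folklore] -/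
theorem dvd_of_lift_eq_zero (hr₀ : ((r₀ : ℤ) : ZMod p) = (r : ZMod p)) (hN : r₀ ^ 2 - d = p) {x : ℤ√d}
    (hx : Zsqrtd.lift r x = 0) : (⟨-r₀, 1⟩ : ℤ√d) ∣ x := by
  obtain ⟨a, b⟩ := x
  rw [lift_mk, ← hr₀] at hx
  have h1 : (((a + b * r₀ : ℤ)) : ZMod p) = 0 := by push_cast; exact hx
  obtain ⟨k, hk⟩ := (ZMod.intCast_zmod_eq_zero_iff_dvd _ _).mp h1
  refine ⟨⟨b - r₀ * k, -k⟩, ?_⟩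
  ext
  · simp only [Zsqrtd.re_mul]
    linear_combination hk - k * hN
  · simp only [Zsqrtd.im_mul]
    ring

/-- **`π ∣ x ⇒ ρ(x) = 0`.**
research route conditional on HC_CM; not a corollary; Q11.4-sentence-2 already refuted in dim ≥ 3. [folklore] -/
theorem lift_eq_zero_of_dvd (hr₀ : ((r₀ : ℤ) : ZMod p) = (r : ZMod p)) {x : ℤ√d}
    (hx : (⟨-r₀, 1⟩ : ℤ√d) ∣ x) : Zsqrtd.lift r x = 0 := by
  obtain ⟨y, rfl⟩ := hx
  rw [map_mul, lift_pi r hr₀, zero_mul]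

/-- **`π` is a prime element of `ℤ[√d]`**: `π ∣ xy ⇒ π ∣ x ∨ π ∣ y` (`ℤ/p` is a field).
research route conditional on HC_CM; not a corollary; Q11.4-sentence-2 already refuted in dim ≥ 3. [folklore] -/
theorem dvd_or_dvd_of_dvd_mul (hr₀ : ((r₀ : ℤ) : ZMod p) = (r : ZMod p)) (hN : r₀ ^ 2 - d = p)
    {x y : ℤ√d} (h : (⟨-r₀, 1⟩ : ℤ√d) ∣ x * y) : (⟨-r₀, 1⟩ : ℤ√d) ∣ x ∨ (⟨-r₀, 1⟩ : ℤ√d) ∣ y := by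
  have h1 := lift_eq_zero_of_dvd r hr₀ h
  rw [map_mul] at h1
  rcases mul_eq_zero.mp h1 with h2 | h2
  · exact Or.inl (dvd_of_lift_eq_zero r hr₀ hN h2)
  · exact Or.inr (dvd_of_lift_eq_zero r hr₀ hN h2)

omit [Fact p.Prime] in
/-- `π·π̄ = p` with `π̄ = −r₀ − √d` (`r₀² − d = p`).
research route conditional on HC_CM; not a corollary; Q11.4-sentence-2 already refuted in dim ≥ 3. [folklore] -/
theorem pi_mul_piBar (hN : r₀ ^ 2 - d = p) : (⟨-r₀, 1⟩ : ℤ√d) * ⟨-r₀, -1⟩ = (p : ℤ√d) := by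
  ext
  · simp only [Zsqrtd.re_mul, Zsqrtd.re_natCast]; linear_combination hN
  · simp only [Zsqrtd.im_mul, Zsqrtd.im_natCast]; ring

omit [Fact p.Prime] in
/-- `N(π) = p`.
research route conditional on HC_CM; not a corollary; Q11.4-sentence-2 already refuted in dim ≥ 3. [folklore] -/
theorem norm_pi (hN : r₀ ^ 2 - d = p) : (⟨-r₀, 1⟩ : ℤ√d).norm = p := by
  rw [Zsqrtd.norm_def]; simp only; linear_combination hN

/-- Cancellation of a non-zero rational integer in `ℤ[√d]` (componentwise; valid for every `d`).
research route conditional on HC_CM; not a corollary; Q11.4-sentence-2 already refuted in dim ≥ 3. [folklore] -/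
theorem eq_of_natCast_mul_eq {x y : ℤ√d} (h : (p : ℤ√d) * x = (p : ℤ√d) * y) : x = y := by
  have hp : (p : ℤ) ≠ 0 := by exact_mod_cast (Fact.out : p.Prime).ne_zero
  have hre := congrArg Zsqrtd.re h
  have him := congrArg Zsqrtd.im h
  simp only [Zsqrtd.re_mul, Zsqrtd.im_mul, Zsqrtd.re_natCast, Zsqrtd.im_natCast, mul_zero, zero_mul,
    add_zero] at hre him
  ext
  · exact mul_left_cancel₀ hp hre
  · exact mul_left_cancel₀ hp him

/-- **Cancellation of `π`**: `π·x = π·y ⇒ x = y` (multiply by `π̄`: `p·x = p·y`).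
research route conditional on HC_CM; not a corollary; Q11.4-sentence-2 already refuted in dim ≥ 3. [folklore] -/
theorem eq_of_pi_mul_eq (hN : r₀ ^ 2 - d = p) {x y : ℤ√d}
    (h : (⟨-r₀, 1⟩ : ℤ√d) * x = (⟨-r₀, 1⟩ : ℤ√d) * y) : x = y := by
  apply eq_of_natCast_mul_eq (p := p)
  rw [← pi_mul_piBar hN, mul_comm (⟨-r₀, 1⟩ : ℤ√d), mul_assoc, mul_assoc, h]

/-- **THE DESCENT at a split prime.**  Let `ρ(γ) ≠ 0` (`π ∤ γ`) and `2r₀ ≢ 0 (mod p)` (`π ∤ π̄`).  If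
`A² − pγC² = Y·D²` in `ℤ[√d]` with `N(D) ≠ 0` and `ρ(Y) ≠ 0`, then `ρ(Y)` is a square in `ℤ/p`.  (Strong
induction on `|N(D)|`.  `π ∤ A`: reducing, `ρ(A)² = ρ(Y)ρ(D)²` with `ρ(A) ≠ 0`, so `ρ(D) ≠ 0` and
`ρ(Y) = (ρ(A)/ρ(D))²`.  `π ∣ A`: then `ρ(Y)ρ(D)² = 0` forces `π ∣ D`; writing `A = πA₁`, `D = πD₁`, `p = ππ̄` and
cancelling `π`: `π̄γC² = π(A₁² − YD₁²)`, so `π ∣ C` (`π` prime, `π ∤ π̄`, `π ∤ γ`), `C = πC₁`, and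
`A₁² − pγC₁² = Y·D₁²` with `|N(D₁)| = |N(D)|/p < |N(D)|`; `Y` is unchanged.)
research route conditional on HC_CM; not a corollary; Q11.4-sentence-2 already refuted in dim ≥ 3. [folklore] -/
theorem isSquare_lift_of_eq (hr₀ : ((r₀ : ℤ) : ZMod p) = (r : ZMod p)) (hN : r₀ ^ 2 - d = p)
    (h2r : (2 * r₀ : ZMod p) ≠ 0) {γ : ℤ√d} (hγ : Zsqrtd.lift r γ ≠ 0)
    (A C Y D : ℤ√d) (hD : D.norm ≠ 0) (hE : A * A - p * γ * (C * C) = Y * (D * D))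
    (hY : Zsqrtd.lift r Y ≠ 0) : IsSquare (Zsqrtd.lift r Y) := by
  have hp : p.Prime := Fact.out
  suffices H : ∀ n : ℕ, ∀ (A C D : ℤ√d), D.norm.natAbs = n → D.norm ≠ 0 →
      A * A - p * γ * (C * C) = Y * (D * D) → IsSquare (Zsqrtd.lift r Y) from H _ A C D rfl hD hE
  intro n
  induction n using Nat.strong_induction_on with
  | _ n ih =>
  intro A C D hn hD hE
  have hpππ : (p : ℤ√d) = ⟨-r₀, 1⟩ * ⟨-r₀, -1⟩ := (pi_mul_piBar hN).symm
  by_cases hA : (⟨-r₀, 1⟩ : ℤ√d) ∣ A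
  · -- `π ∣ A`: then `π ∣ D`, `π ∣ C`, and we descend
    have hρA : Zsqrtd.lift r A = 0 := lift_eq_zero_of_dvd r hr₀ hA
    have hρE := congrArg (Zsqrtd.lift r) hE
    simp only [map_sub, map_mul, hρA, map_natCast, ZMod.natCast_self, zero_mul, sub_zero] at hρE
    have hρD : Zsqrtd.lift r D = 0 := by
      rcases mul_eq_zero.mp hρE.symm with h | h
      · exact absurd h hY
      · exact mul_self_eq_zero.mp h
    obtain ⟨A₁, rfl⟩ := hA
    obtain ⟨D₁, rfl⟩ := dvd_of_lift_eq_zero r hr₀ hN hρD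
    -- cancel one `π`: `π̄ γ C² = π (A₁² − Y D₁²)`
    have h1 : (⟨-r₀, 1⟩ : ℤ√d) * (⟨-r₀, -1⟩ * γ * (C * C)) =
        (⟨-r₀, 1⟩ : ℤ√d) * ((⟨-r₀, 1⟩ : ℤ√d) * (A₁ * A₁ - Y * (D₁ * D₁))) := by
      rw [hpππ] at hE
      linear_combination -hE
    have h2 : ⟨-r₀, -1⟩ * γ * (C * C) = (⟨-r₀, 1⟩ : ℤ√d) * (A₁ * A₁ - Y * (D₁ * D₁)) :=
      eq_of_pi_mul_eq hN h1
    have hC : (⟨-r₀, 1⟩ : ℤ√d) ∣ C := by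
      have h3 : (⟨-r₀, 1⟩ : ℤ√d) ∣ ⟨-r₀, -1⟩ * γ * (C * C) := ⟨_, h2⟩
      rcases dvd_or_dvd_of_dvd_mul r hr₀ hN h3 with h4 | h4
      · rcases dvd_or_dvd_of_dvd_mul r hr₀ hN h4 with h5 | h5
        · exfalso
          have h6 := lift_eq_zero_of_dvd r hr₀ h5
          rw [lift_mk, ← hr₀] at h6
          push_cast at h6
          exact h2r (by linear_combination -h6)
        · exact absurd (lift_eq_zero_of_dvd r hr₀ h5) hγ
      · rcases dvd_or_dvd_of_dvd_mul r hr₀ hN h4 with h5 | h5 <;> exact h5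
    obtain ⟨C₁, rfl⟩ := hC
    have hE' : A₁ * A₁ - p * γ * (C₁ * C₁) = Y * (D₁ * D₁) := by
      have h3 : (⟨-r₀, 1⟩ : ℤ√d) * ((⟨-r₀, 1⟩ : ℤ√d) * (⟨-r₀, -1⟩ * γ * (C₁ * C₁))) =
          (⟨-r₀, 1⟩ : ℤ√d) * (A₁ * A₁ - Y * (D₁ * D₁)) := by
        linear_combination h2
      have h4 := eq_of_pi_mul_eq hN h3
      rw [hpππ]
      linear_combination -h4
    have hD₁ : D₁.norm ≠ 0 := by
      intro h; apply hD; rw [Zsqrtd.norm_mul, h, mul_zero]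
    refine ih D₁.norm.natAbs ?_ A₁ C₁ D₁ rfl hD₁ hE'
    rw [← hn, Zsqrtd.norm_mul, Int.natAbs_mul, norm_pi hN, Int.natAbs_natCast]
    have := Int.natAbs_pos.mpr hD₁
    nlinarith [hp.two_le]
  · -- `π ∤ A`: reduce modulo `π`
    have hρA : Zsqrtd.lift r A ≠ 0 := fun h => hA (dvd_of_lift_eq_zero r hr₀ hN h)
    have hρE := congrArg (Zsqrtd.lift r) hE
    simp only [map_sub, map_mul, map_natCast, ZMod.natCast_self, zero_mul, sub_zero] at hρE
    have hρD : Zsqrtd.lift r D ≠ 0 := by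
      intro h
      rw [h, mul_zero, mul_zero] at hρE
      exact hρA (mul_self_eq_zero.mp hρE)
    refine ⟨Zsqrtd.lift r A * (Zsqrtd.lift r D)⁻¹, ?_⟩
    field_simp
    linear_combination -hρE

end Split

/-! ### §2 Clearing denominators: rational coordinates -/

/-- **Rational coordinates.**  `a = a₁ + a₂√d`, `c = c₁ + c₂√d` (`aᵢ, cᵢ ∈ ℚ`), `β = p·(g₁ + g₂√d)`
(`gᵢ ∈ ℤ`), and suppose `2(a² − βc²) = U + V√d` with `U, V ∈ ℤ` (coordinates: `c² = P + Q√d`,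
`P = c₁² + dc₂²`, `Q = 2c₁c₂`; `a² − βc² = (a₁² + da₂² − β₁P − dβ₂Q) + (2a₁a₂ − β₁Q − β₂P)√d`).  If
`p ∤ U² − dV²` (e.g. `U² − dV² = ±4`, `p` odd) then, for the reduction `ρ : √d ↦ r₀` at a split prime as in §1
(`r₀² − d = p`, `2r₀ ≢ 0`, `ρ(g₁ + g₂√d) ≠ 0`), **`2(U + Vr₀)` is a non-zero square mod `p`**.  (Common
denominator `d₀ = ∏ den`: `(2d₀a)² − β(2d₀c)² = (2U + 2V√d)·d₀²` in `ℤ[√d]`, `N(d₀) = d₀² ≠ 0`; §1.)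
research route conditional on HC_CM; not a corollary; Q11.4-sentence-2 already refuted in dim ≥ 3. [folklore] -/
theorem isSquare_lift_of_coords {d : ℤ} {p : ℕ} [Fact p.Prime] (r : { r : ZMod p // r * r = (d : ZMod p) })
    {r₀ : ℤ} (hr₀ : ((r₀ : ℤ) : ZMod p) = (r : ZMod p)) (hN : r₀ ^ 2 - d = p) (h2r : (2 * r₀ : ZMod p) ≠ 0)
    {g₁ g₂ : ℤ} (hγ : (g₁ : ZMod p) + (g₂ : ZMod p) * (r : ZMod p) ≠ 0)
    (a₁ a₂ c₁ c₂ : ℚ) {U V : ℤ}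
    (hU : (U : ℚ) = 2 * (a₁ ^ 2 + d * a₂ ^ 2 - (p * g₁) * (c₁ ^ 2 + d * c₂ ^ 2) - d * (p * g₂) * (2 * c₁ * c₂)))
    (hV : (V : ℚ) = 2 * (2 * a₁ * a₂ - (p * g₁) * (2 * c₁ * c₂) - (p * g₂) * (c₁ ^ 2 + d * c₂ ^ 2)))
    (hUV : ¬ (p : ℤ) ∣ U ^ 2 - d * V ^ 2) :
    IsSquare ((2 * U : ZMod p) + (2 * V : ZMod p) * (r : ZMod p)) ∧
      (2 * U : ZMod p) + (2 * V : ZMod p) * (r : ZMod p) ≠ 0 := by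
  have hp : p.Prime := Fact.out
  -- non-vanishing of `ρ(2U + 2V√d)`
  have hp2 : (2 : ZMod p) ≠ 0 := by
    intro h
    have h4 : ((2 * r₀ : ℤ) : ZMod p) = 0 := by push_cast; rw [h, zero_mul]
    exact h2r (by exact_mod_cast h4)
  have hY : (2 * U : ZMod p) + (2 * V : ZMod p) * (r : ZMod p) ≠ 0 := by
    intro h
    have h1 : ((U : ZMod p) + (V : ZMod p) * r) * 2 = 0 := by linear_combination h
    have h2 : (U : ZMod p) + (V : ZMod p) * r = 0 := by
      rcases mul_eq_zero.mp h1 with h3 | h3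
      · exact h3
      · exact absurd h3 hp2
    have h3 : ((U ^ 2 - d * V ^ 2 : ℤ) : ZMod p) = 0 := by
      push_cast
      have hr2 : (r : ZMod p) * (r : ZMod p) = (d : ZMod p) := r.2
      linear_combination ((U : ZMod p) - (V : ZMod p) * r) * h2 + (V : ZMod p) ^ 2 * hr2
    exact hUV ((ZMod.intCast_zmod_eq_zero_iff_dvd _ _).mp h3)
  refine ⟨?_, hY⟩
  -- common denominator and integral coordinates
  set d₀ : ℕ := a₁.den * a₂.den * c₁.den * c₂.den with hd₀
  have hd₀0 : d₀ ≠ 0 := by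
    rw [hd₀]
    exact Nat.mul_ne_zero (Nat.mul_ne_zero (Nat.mul_ne_zero a₁.den_nz a₂.den_nz) c₁.den_nz) c₂.den_nz
  set A₁ : ℤ := 2 * a₁.num * ((a₂.den * c₁.den * c₂.den : ℕ) : ℤ) with hA₁
  set A₂ : ℤ := 2 * a₂.num * ((a₁.den * c₁.den * c₂.den : ℕ) : ℤ) with hA₂
  set C₁ : ℤ := 2 * c₁.num * ((a₁.den * a₂.den * c₂.den : ℕ) : ℤ) with hC₁
  set C₂ : ℤ := 2 * c₂.num * ((a₁.den * a₂.den * c₁.den : ℕ) : ℤ) with hC₂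
  have hA₁' : (A₁ : ℚ) = 2 * d₀ * a₁ := by
    rw [hA₁, hd₀]; push_cast; rw [← Rat.mul_den_eq_num a₁]; ring
  have hA₂' : (A₂ : ℚ) = 2 * d₀ * a₂ := by
    rw [hA₂, hd₀]; push_cast; rw [← Rat.mul_den_eq_num a₂]; ring
  have hC₁' : (C₁ : ℚ) = 2 * d₀ * c₁ := by
    rw [hC₁, hd₀]; push_cast; rw [← Rat.mul_den_eq_num c₁]; ring
  have hC₂' : (C₂ : ℚ) = 2 * d₀ * c₂ := by
    rw [hC₂, hd₀]; push_cast; rw [← Rat.mul_den_eq_num c₂]; ring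
  -- the integral equation `A·A − pγ·C·C = (2U + 2V√d)·d₀²`
  have key : (⟨A₁, A₂⟩ : ℤ√d) * ⟨A₁, A₂⟩ - p * ⟨g₁, g₂⟩ * ((⟨C₁, C₂⟩ : ℤ√d) * ⟨C₁, C₂⟩) =
      ⟨2 * U, 2 * V⟩ * ((d₀ : ℤ√d) * (d₀ : ℤ√d)) := by
    ext
    · simp only [Zsqrtd.re_sub, Zsqrtd.re_mul, Zsqrtd.im_mul, Zsqrtd.re_natCast, Zsqrtd.im_natCast]
      apply Int.cast_injective (α := ℚ)
      push_cast
      rw [hA₁', hA₂', hC₁', hC₂', hU]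
      ring
    · simp only [Zsqrtd.re_mul, Zsqrtd.im_mul, Zsqrtd.re_natCast, Zsqrtd.im_natCast, Zsqrtd.im_sub]
      apply Int.cast_injective (α := ℚ)
      push_cast
      rw [hA₁', hA₂', hC₁', hC₂', hV]
      ring
  have hDn : ((d₀ : ℤ√d)).norm ≠ 0 := by
    rw [Zsqrtd.norm_natCast]
    exact mul_ne_zero (by exact_mod_cast hd₀0) (by exact_mod_cast hd₀0)
  have hγ' : Zsqrtd.lift r (⟨g₁, g₂⟩ : ℤ√d) ≠ 0 := by rw [lift_mk]; exact hγ
  have hY' : Zsqrtd.lift r (⟨2 * U, 2 * V⟩ : ℤ√d) ≠ 0 := by rw [lift_mk]; push_cast; exact hY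
  have h := isSquare_lift_of_eq r hr₀ hN h2r hγ' ⟨A₁, A₂⟩ ⟨C₁, C₂⟩ ⟨2 * U, 2 * V⟩ (d₀ : ℤ√d) hDn key hY'
  rw [lift_mk] at h
  push_cast at h
  exact h

end Summit.HodgeConjecture.Ring2WeilCoverage.SplitPrimeDescent
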